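import Literature.Geometry.Riemannian.L2HarmonicOneFormsSobolev
import Literature.Geometry.Lorentzian.MetricNormSq
import HarnessLib

/-!
# Towards Carron's finiteness theorem for `ℋ¹(X, h)`: Kato's inequality for `1`-forms

First layer of the proof programme of the named fact
`Literature.Geometry.Riemannian.Carron1999_finrank_l2HarmonicOneForms_le` (Carron 1999;
Carron's habilitation memoir, Thm. 4.3, `k = 1`): under a Sobolev inequality `(S_p)` and
`Ric ∈ L^{p/2}`, `ℋ¹(X, h)` is finite dimensional with `dim ≤ C(n, p, μ) ∫ |Ric|^{p/2}`.
The printed proof (memoir §4.a–§4.b, pp. 21–24) runs: Bochner–Weitzenböck `Δ₁ = ∇*∇ + Ric`;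
**Kato's inequality `|d|α|| ≤ |∇α|`**; the Sobolev inequality transported to forms; boundedness
and compactness of `Δ̄^{-1/2} R₁ Δ̄^{-1/2}` on `L²`; injectivity of `√Δ̄ : ℋ¹ → ker(Id + ·)`; a
Cwikel–Lieb–Rozenblum count for the bound. This file proves the Kato step, in the vocabulary of
`RelativeL2HarmonicOneForms.lean` (`covDerivOneForm`, `innerDual`, `normSq`), bottom-up (the
sibling `L2HarmonicOneFormsSobolevProofs.lean` holds the reductions for the companion fact
`Carron1998_ends_le_rank_l2HarmonicOneForms`):

* `innerDual_sq_le` — Cauchy–Schwarz for `h⁻¹` (Riemannian `h`);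
* `contMDiffAt_sharp_oneForm` — `♯α` is a `C^m` vector field for a `C^m` `1`-form `α`
  (any pseudo-Riemannian `g`; coordinate frame expansion `♯α = ∑ (∑ α(∂ₖ) gᵏˡ) ∂ₗ`);
* `mvfderiv_innerDual_oneForm` — **metric compatibility on `1`-forms**,
  `v g⁻¹(α, β) = g⁻¹(∇_v α, β) + g⁻¹(α, ∇_v β)` (any `g` with its Levi-Civita connection;
  O'Neill 1983, Ch. 3, Thm. 3.11 (D4) on `♯α, ♯β` and `(∇_v α)(Y) = v(α Y) - α(∇_v Y)`);
* `innerDual_eq_sum_div` — `g⁻¹(γ, δ) = ∑ᵢ γ(eᵢ) δ(eᵢ)/g(eᵢ, eᵢ)` in an orthogonal frame;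
* `mvfderiv_innerDual_self`, `kato_sq_apply`, `kato_sq`, `kato`, `kato_of_mem_l2HarmonicOneForms`
  — **Kato's inequality** for `1`-forms of a Riemannian metric: `v|α|² = 2 h⁻¹(∇_v α, α)`,
  `(v|α|²)² ≤ 4 |α|² |∇_v α|²`, `|d|α|²|² ≤ 4 |α|² |∇α|²` (`|∇α|² = normSq ∇α`, summed over an
  `h`-orthogonal frame with `normSq_eq_sum_sq`), and `|d|α||² ≤ |∇α|²` wherever `α ≠ 0`, in
  particular for members of `ℋ¹(X, h)` (Carron 1999HdR, §4.a, proof of Prop. 4.2: "l'inégalité de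
  Kato i.e. si `α` est une forme différentielle lisse alors `|∇α|(x) ≥ |d|α||(x)`").

Everything is proved; no definitions, no named facts (D-0026). Not here (the remaining steps of
the printed proof): the Bochner–Weitzenböck formula for `1`-forms, cut-offs/integration by parts
on the complete manifold, the space `H¹₀` of forms and the compactness argument, the CLR bound.

## References

* G. Carron, *Formes harmoniques L² sur les variétés riemanniennes non-compactes*, mémoire
  d'habilitation (1999) = Rend. Mat. Appl. (7) 21 (2001), §4.a (Bochner–Weitzenböck, Kato,
  Prop. 4.1–4.2), §4.b Thm. 4.3 and its proof sketch (pp. 21–24 of the author's PDF).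
  [`Carron1999HdR`]
* G. Carron, *L²-cohomologie et inégalités de Sobolev*, Math. Ann. 314 (1999) 613–639 (the
  finiteness theorem, [C4] of the memoir). [`Carron1999`]
* B. O'Neill, *Semi-Riemannian geometry* (1983), Ch. 3, Thm. 3.11, pp. 60–61 (metric
  compatibility; musical isomorphisms and frame expansions). [`ONeill1983`]
-/

noncomputable section

open Bundle Set Function Filter FiberBundle
open scoped Manifold ContDiff Topology

namespace Literature.Geometry.Riemannian

open _root_.MeasureTheory Literature.Geometry.Lorentzian

variable {E : Type*} [NormedAddCommGroup E] [NormedSpace ℝ E] {H : Type*} [TopologicalSpace H]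
  {I : ModelWithCorners ℝ E H} {X : Type*} [TopologicalSpace X] [ChartedSpace H X]
  [IsManifold I ∞ X] [FiniteDimensional ℝ E] {x : X}

/-- **Cauchy–Schwarz for the inverse metric** of a Riemannian metric:
`h⁻¹(a, b)² ≤ h⁻¹(a, a) h⁻¹(b, b)` (discriminant of `t ↦ h⁻¹(a + t b, a + t b) ≥ 0`).
[folklore] -/
theorem innerDual_sq_le (h : ContMDiffRiemannianMetric I ∞ E (TangentSpace I : X → Type _)) (x : X)
    (a b : Module.Dual ℝ (TangentSpace I x)) :
    (PseudoRiemannianMetric.ofRiemannian h).innerDual x a b ^ 2 ≤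
      (PseudoRiemannianMetric.ofRiemannian h).innerDual x a a *
        (PseudoRiemannianMetric.ofRiemannian h).innerDual x b b := by
  have hquad : ∀ t : ℝ, 0 ≤ (PseudoRiemannianMetric.ofRiemannian h).innerDual x a a +
      2 * t * (PseudoRiemannianMetric.ofRiemannian h).innerDual x a b +
      t ^ 2 * (PseudoRiemannianMetric.ofRiemannian h).innerDual x b b := by
    intro t
    have h0 := innerDual_self_nonneg (h := h) x (a + t • b)
    have hs := (PseudoRiemannianMetric.ofRiemannian h).innerDual_comm x a b
    simp only [PseudoRiemannianMetric.innerDual, map_add, map_smul, LinearMap.add_apply,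
      LinearMap.smul_apply, smul_eq_mul] at h0 hs ⊢
    rw [← hs] at h0
    convert h0 using 1
    ring
  set A := (PseudoRiemannianMetric.ofRiemannian h).innerDual x a a
  set B := (PseudoRiemannianMetric.ofRiemannian h).innerDual x a b
  set C := (PseudoRiemannianMetric.ofRiemannian h).innerDual x b b
  have hA : 0 ≤ A := innerDual_self_nonneg (h := h) x a
  have hC : 0 ≤ C := innerDual_self_nonneg (h := h) x b
  by_cases hC0 : C = 0
  · -- then `B = 0`
    have hB : B = 0 := by
      by_contra hB
      have h1 := hquad (-(A + 1) / (2 * B))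
      rw [hC0] at h1
      have : A + 2 * (-(A + 1) / (2 * B)) * B = -1 := by field_simp; ring
      linarith
    rw [hB, hC0]; simp
  · have hCpos : 0 < C := lt_of_le_of_ne hC (Ne.symm hC0)
    have h1 := hquad (-B / C)
    have : A + 2 * (-B / C) * B + (-B / C) ^ 2 * C = A - B ^ 2 / C := by
      field_simp; ring
    rw [this] at h1
    have h2 : B ^ 2 / C ≤ A := by linarith
    rwa [div_le_iff₀ hCpos] at h2


/-- **Raising the index of a `C^m` `1`-form gives a `C^m` vector field**: if `α` is `C^m` at `x`
as a section of `T*X` then `y ↦ ♯_y α_y` is `C^m` at `x` as a section of `TX` (in the coordinate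
frame `∂ₗ`, `♯α = ∑ₗ (∑ₖ α(∂ₖ) gᵏˡ) ∂ₗ` with `gᵏˡ` smooth). O'Neill 1983, Ch. 3, p. 60
(metrically equivalent vector fields and one-forms). [folklore] -/
theorem contMDiffAt_sharp_oneForm (g : PseudoRiemannianMetric I ∞ E (TangentSpace I : X → Type _))
    {m : ℕ∞ω} (hm : m ≤ (∞ : ℕ∞ω)) {α : Π x : X, TangentSpace I x →L[ℝ] ℝ}
    (hα : ContMDiffAt I (I.prod 𝓘(ℝ, E →L[ℝ] ℝ)) m (oneFormSection α) x) :
    ContMDiffAt I (I.prod 𝓘(ℝ, E)) m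
      (fun y ↦ TotalSpace.mk' E y (g.sharp y (α y).toLinearMap : TangentSpace I y)) x := by
  classical
  set e := trivializationAt E (TangentSpace I) x
  set bE := Module.finBasis ℝ E
  have hxe : x ∈ e.baseSet := FiberBundle.mem_baseSet_trivializationAt' x
  have hfr : ∀ i, ContMDiffAt I (I.prod 𝓘(ℝ, E)) m
      (fun p ↦ TotalSpace.mk' E p (e.localFrame bE i p)) x := fun i ↦
    (contMDiffAt_localFrame_of_mem ∞ e bE i hxe).of_le hm
  have hpair : ∀ i, ContMDiffAt I 𝓘(ℝ, ℝ) m (fun p ↦ α p (e.localFrame bE i p)) x := by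
    intro i
    have : ContMDiffAt I (I.prod 𝓘(ℝ, ℝ)) m
        (fun p ↦ TotalSpace.mk' ℝ (E := Bundle.Trivial X ℝ) p (α p (e.localFrame bE i p))) x := by
      apply ContMDiffAt.clm_bundle_apply (F₁ := E)
      · exact hα
      · exact hfr i
    simp only [contMDiffAt_totalSpace] at this
    exact this.2
  have hGinv : ∀ k l, ContMDiffAt I 𝓘(ℝ, ℝ) m (fun p ↦ (Matrix.of fun i j ↦
      g.val p (e.localFrame bE i p) (e.localFrame bE j p))⁻¹ k l) x := fun k l ↦
    ((contMDiffOn_gram_localFrame_inv e g bE k l x hxe).contMDiffAt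
      (e.open_baseSet.mem_nhds hxe)).of_le hm
  set c : Fin (Module.finrank ℝ E) → X → ℝ := fun l p ↦ ∑ k, α p (e.localFrame bE k p) *
      (Matrix.of fun i j ↦ g.val p (e.localFrame bE i p) (e.localFrame bE j p))⁻¹ k l with hc_def
  have hc : ∀ l, ContMDiffAt I 𝓘(ℝ, ℝ) m (c l) x :=
    fun l ↦ contMDiffAt_finsetSum fun k _ ↦ (hpair k).mul (hGinv k l)
  have hS : ContMDiffAt I (I.prod 𝓘(ℝ, E)) m
      (fun p ↦ TotalSpace.mk' E p (∑ l ∈ Finset.univ, (c l • e.localFrame bE l) p)) x :=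
    ContMDiffAt.sum_section fun l _ ↦ (hc l).smul_section (hfr l)
  refine hS.congr_of_eventuallyEq ?_
  have hsrc : ∀ᶠ p in 𝓝 x, p ∈ (chartAt H x).source :=
    (chartAt H x).open_source.mem_nhds (mem_chart_source H x)
  filter_upwards [hsrc] with p hp
  congr 1
  conv_lhs => rw [eq_sum_gram_inv_smul_localFrame g bE hp (g.sharp p (α p).toLinearMap)]
  simp only [g.val_sharp_apply, ContinuousLinearMap.coe_coe, Pi.smul_apply', hc_def]
  rfl


section Compat

variable [CompleteSpace E] (g : PseudoRiemannianMetric I ∞ E (TangentSpace I : X → Type _))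
  [g.HasLeviCivita]

/-- **Metric compatibility on `1`-forms.** For `1`-forms `α, β` of class `C^m`, `1 ≤ m ≤ ∞`, at
`x` and `v ∈ T_x X`: `v (g⁻¹(α, β)) = g⁻¹(∇_v α, β) + g⁻¹(α, ∇_v β)`, where
`∇_v α = (∇α)_x(·, v)` (`covDerivOneForm`, derivative slot last). From the compatibility of the
Levi-Civita connection with `g` on the vector fields `♯α, ♯β` and the defining formula
`(∇_v α)(Y) = v(α(Y)) - α(∇_v Y)`. O'Neill 1983, Ch. 3, Prop. 3.12 ff. (the Levi-Civita
connection commutes with metric contraction / type changing). [cite: ONeill1983, Ch. 3, Thm. 3.11 (D4)] -/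
theorem mvfderiv_innerDual_oneForm {m : ℕ∞ω} (hm : m ≤ (∞ : ℕ∞ω)) (h1 : 1 ≤ m)
    {α β : Π x : X, TangentSpace I x →L[ℝ] ℝ}
    (hα : ContMDiffAt I (I.prod 𝓘(ℝ, E →L[ℝ] ℝ)) m (oneFormSection α) x)
    (hβ : ContMDiffAt I (I.prod 𝓘(ℝ, E →L[ℝ] ℝ)) m (oneFormSection β) x) (v : TangentSpace I x) :
    mvfderiv I (fun y ↦ g.innerDual y (α y).toLinearMap (β y).toLinearMap) x v =
      g.innerDual x ((g.covDerivOneForm α x).flip v) (β x).toLinearMap +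
        g.innerDual x (α x).toLinearMap ((g.covDerivOneForm β x).flip v) := by
  have hm0 : m ≠ 0 := by
    intro h0; rw [h0] at h1; exact absurd h1 (by norm_num)
  -- the vector fields `♯α`, `♯β` and the extension `V` of `v`
  set Sα : Π y : X, TangentSpace I y := fun y ↦ g.sharp y (α y).toLinearMap with hSα_def
  set Sβ : Π y : X, TangentSpace I y := fun y ↦ g.sharp y (β y).toLinearMap with hSβ_def
  have hSα : MDiffAt (T% Sα) x := (contMDiffAt_sharp_oneForm g hm hα).mdifferentiableAt hm0
  have hSβ : MDiffAt (T% Sβ) x := (contMDiffAt_sharp_oneForm g hm hβ).mdifferentiableAt hm0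
  have hαd : MDifferentiableAt I (I.prod 𝓘(ℝ, E →L[ℝ] ℝ)) (oneFormSection α) x :=
    hα.mdifferentiableAt hm0
  have hβd : MDifferentiableAt I (I.prod 𝓘(ℝ, E →L[ℝ] ℝ)) (oneFormSection β) x :=
    hβ.mdifferentiableAt hm0
  set V : Π y : X, TangentSpace I y := FiberBundle.extend E v
  have hV : MDiffAt (T% V) x := mdifferentiableAt_extend ..
  have hVx : V x = v := extend_apply_self ..
  -- the three functions `y ↦ g⁻¹(α, β)`, `y ↦ α(♯β)`, `y ↦ β(♯α)`, `y ↦ g(♯α, ♯β)` coincide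
  have e1 : (fun y ↦ g.innerDual y (α y).toLinearMap (β y).toLinearMap) = fun y ↦ α y (Sβ y) := by
    funext y; rfl
  have e2 : (fun y ↦ β y (Sα y)) = fun y ↦ α y (Sβ y) := by
    funext y
    have := g.innerDual_comm y (β y).toLinearMap (α y).toLinearMap
    simpa [PseudoRiemannianMetric.innerDual] using this
  have e3 : (fun y ↦ g.val y (Sα y) (Sβ y)) = fun y ↦ α y (Sβ y) := by
    funext y; simp [hSα_def]
  -- (1) `D = (∇_v α)(♯β) + α(∇_v ♯β)`
  have h1' := covDerivOneForm_apply (g := g) hαd hSβ V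
  -- (3) `D = (∇_v β)(♯α) + β(∇_v ♯α)`
  have h3' := covDerivOneForm_apply (g := g) hβd hSα V
  -- (2) compatibility `D = g(∇_v ♯α, ♯β) + g(♯α, ∇_v ♯β)`
  have h2' := (PseudoRiemannianMetric.isLeviCivita_leviCivita_holds (g := g)).2 hV hSα hSβ
  simp only [PseudoRiemannianMetric.covDerivOneFormAux, hVx] at h1' h3' h2'
  rw [e2] at h3'
  rw [e3] at h2'
  rw [e1]
  -- assemble
  have hval1 : g.val x (Sα x) (g.leviCivita Sβ x v) = α x (g.leviCivita Sβ x v) := by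
    simp [hSα_def]
  have hval2 : g.val x (g.leviCivita Sα x v) (Sβ x) = β x (g.leviCivita Sα x v) := by
    rw [g.symm]; simp [hSβ_def]
  rw [hval1, hval2] at h2'
  simp only [LinearMap.BilinForm.flip_apply, PseudoRiemannianMetric.innerDual]
  have hx1 : g.sharp x (β x).toLinearMap = Sβ x := rfl
  rw [hx1]
  -- `innerDual x (α x) (∇_v β) = (∇_v β)(♯α)`:
  have hcomm : (α x).toLinearMap (g.sharp x ((g.covDerivOneForm β x).flip v)) =
      (g.covDerivOneForm β x) (Sα x) v := by
    have := g.innerDual_comm x (α x).toLinearMap ((g.covDerivOneForm β x).flip v)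
    simpa [PseudoRiemannianMetric.innerDual] using this
  rw [hcomm]
  linarith

end Compat

section Frame

variable (g : PseudoRiemannianMetric I ∞ E (TangentSpace I : X → Type _))

/-- **The inverse metric in an orthogonal frame**: for a `g_x`-orthogonal basis `e` of `T_x X`
of non-null vectors, `g⁻¹(γ, δ) = ∑ᵢ γ(eᵢ) δ(eᵢ) / g(eᵢ, eᵢ)` (`♯δ = ∑ᵢ (δ(eᵢ)/g(eᵢ,eᵢ)) eᵢ`).
O'Neill 1983, Ch. 3, pp. 60–61 (frame expansions). [folklore] -/
theorem innerDual_eq_sum_div {ι : Type*} [Fintype ι] [DecidableEq ι]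
    (e : Module.Basis ι ℝ (TangentSpace I x)) (he : (g.toBilinForm x).IsOrthoᵢ e)
    (hc : ∀ i, g.val x (e i) (e i) ≠ 0) (γ δ : Module.Dual ℝ (TangentSpace I x)) :
    g.innerDual x γ δ = ∑ i, γ (e i) * δ (e i) / g.val x (e i) (e i) := by
  rw [PseudoRiemannianMetric.innerDual]
  conv_lhs => rw [← e.sum_repr (g.sharp x δ)]
  simp only [map_sum, map_smul, smul_eq_mul]
  refine Finset.sum_congr rfl fun i _ ↦ ?_
  rw [repr_eq_div_of_isOrthoᵢ e he hc (g.sharp x δ) i]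
  simp only [PseudoRiemannianMetric.toBilinForm_apply, PseudoRiemannianMetric.val_sharp_apply]
  ring

end Frame

section Kato

variable [CompleteSpace E] (h : ContMDiffRiemannianMetric I ∞ E (TangentSpace I : X → Type _))
  [(PseudoRiemannianMetric.ofRiemannian h).HasLeviCivita]

/-- **`v |α|² = 2 g⁻¹(∇_v α, α)`** for a `C^m` `1`-form, `1 ≤ m ≤ ∞` (metric compatibility,
`mvfderiv_innerDual_oneForm`, with `β = α`). [folklore] -/
theorem mvfderiv_innerDual_self {m : ℕ∞ω} (hm : m ≤ (∞ : ℕ∞ω)) (h1 : 1 ≤ m)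
    {α : Π x : X, TangentSpace I x →L[ℝ] ℝ}
    (hα : ContMDiffAt I (I.prod 𝓘(ℝ, E →L[ℝ] ℝ)) m (oneFormSection α) x) (v : TangentSpace I x) :
    mvfderiv I (fun y ↦ (PseudoRiemannianMetric.ofRiemannian h).innerDual y (α y).toLinearMap
      (α y).toLinearMap) x v =
      2 * (PseudoRiemannianMetric.ofRiemannian h).innerDual x
        (((PseudoRiemannianMetric.ofRiemannian h).covDerivOneForm α x).flip v)
        (α x).toLinearMap := by
  rw [mvfderiv_innerDual_oneForm (PseudoRiemannianMetric.ofRiemannian h) hm h1 hα hα v,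
    (PseudoRiemannianMetric.ofRiemannian h).innerDual_comm x (α x).toLinearMap]
  ring

/-- **Kato's inequality for `1`-forms, directional form**: for a `C^m` `1`-form `α`,
`1 ≤ m ≤ ∞`, and `v ∈ T_x X`, `(v |α|²)² ≤ 4 |α|²_x |∇_v α|²` (i.e. `|v|α|| ≤ |∇_v α|` wherever
`α ≠ 0`): `v|α|² = 2 h⁻¹(∇_v α, α)` and Cauchy–Schwarz for `h⁻¹`. Carron 1999HdR, §4.a, proof
of Prop. 4.2 ("l'inégalité de Kato: `|∇α|(x) ≥ |d|α||(x)`"). [cite: Carron1999HdR, §4.a, Prop. 4.2 (proof)] -/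
theorem kato_sq_apply {m : ℕ∞ω} (hm : m ≤ (∞ : ℕ∞ω)) (h1 : 1 ≤ m)
    {α : Π x : X, TangentSpace I x →L[ℝ] ℝ}
    (hα : ContMDiffAt I (I.prod 𝓘(ℝ, E →L[ℝ] ℝ)) m (oneFormSection α) x) (v : TangentSpace I x) :
    (mvfderiv I (fun y ↦ (PseudoRiemannianMetric.ofRiemannian h).innerDual y (α y).toLinearMap
      (α y).toLinearMap) x v) ^ 2 ≤
      4 * (PseudoRiemannianMetric.ofRiemannian h).innerDual x (α x).toLinearMap (α x).toLinearMap *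
        (PseudoRiemannianMetric.ofRiemannian h).innerDual x
          (((PseudoRiemannianMetric.ofRiemannian h).covDerivOneForm α x).flip v)
          (((PseudoRiemannianMetric.ofRiemannian h).covDerivOneForm α x).flip v) := by
  rw [mvfderiv_innerDual_self h hm h1 hα v]
  have hcs := innerDual_sq_le h x
    (((PseudoRiemannianMetric.ofRiemannian h).covDerivOneForm α x).flip v) (α x).toLinearMap
  nlinarith [hcs]

/-- **Kato's inequality for `1`-forms**: for a `C^m` `1`-form `α`, `1 ≤ m ≤ ∞`, at every point
`|d|α|²|²_h ≤ 4 |α|²_h |∇α|²_h`, where `|∇α|²_h = normSq (∇α)` is the metric square norm of the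
covariant derivative (so `|d|α|| ≤ |∇α|` wherever `α ≠ 0`). In an `h_x`-orthonormal frame this is
the directional inequality `kato_sq_apply` summed over the frame (`innerDual_eq_sum_div`,
`normSq_eq_sum_sq`). Carron 1999HdR, §4.a, proof of Prop. 4.2; Carron 2007, proof of Cor. 2.12
(refined form for harmonic `1`-forms). [cite: Carron1999HdR, §4.a, Prop. 4.2 (proof)] -/
theorem kato_sq {m : ℕ∞ω} (hm : m ≤ (∞ : ℕ∞ω)) (h1 : 1 ≤ m)
    {α : Π x : X, TangentSpace I x →L[ℝ] ℝ}
    (hα : ContMDiffAt I (I.prod 𝓘(ℝ, E →L[ℝ] ℝ)) m (oneFormSection α) x) :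
    (PseudoRiemannianMetric.ofRiemannian h).innerDual x
      (mvfderiv I (fun y ↦ (PseudoRiemannianMetric.ofRiemannian h).innerDual y (α y).toLinearMap
        (α y).toLinearMap) x).toLinearMap
      (mvfderiv I (fun y ↦ (PseudoRiemannianMetric.ofRiemannian h).innerDual y (α y).toLinearMap
        (α y).toLinearMap) x).toLinearMap ≤
      4 * (PseudoRiemannianMetric.ofRiemannian h).innerDual x (α x).toLinearMap (α x).toLinearMap *
        (PseudoRiemannianMetric.ofRiemannian h).normSq x
          ((PseudoRiemannianMetric.ofRiemannian h).covDerivOneForm α x) := by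
  classical
  obtain ⟨e, he, hc⟩ := (PseudoRiemannianMetric.ofRiemannian h).exists_isOrthoᵢ_basis x
  have hpos : ∀ i, 0 < (PseudoRiemannianMetric.ofRiemannian h).val x (e i) (e i) := fun i ↦
    h.pos x (e i) (e.ne_zero i)
  have hAnn : 0 ≤ (PseudoRiemannianMetric.ofRiemannian h).innerDual x (α x).toLinearMap
      (α x).toLinearMap := innerDual_self_nonneg (h := h) x _
  have hdir := fun i ↦ kato_sq_apply h hm h1 hα (e i)
  set G := PseudoRiemannianMetric.ofRiemannian h with hG
  set D := mvfderiv I (fun y ↦ G.innerDual y (α y).toLinearMap (α y).toLinearMap) x with hD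
  set T := G.covDerivOneForm α x with hT
  set A := G.innerDual x (α x).toLinearMap (α x).toLinearMap with hA
  -- both sides in the frame `e`
  rw [innerDual_eq_sum_div G e he hc, G.normSq_eq_sum_sq x e he hc T, Finset.mul_sum]
  refine Finset.sum_le_sum fun i _ ↦ ?_
  have hdi := hdir i
  rw [innerDual_eq_sum_div G e he hc (T.flip (e i)) (T.flip (e i))] at hdi
  simp only [LinearMap.BilinForm.flip_apply] at hdi
  simp only [ContinuousLinearMap.coe_coe]
  have hi := hpos i
  calc D (e i) * D (e i) / G.val x (e i) (e i)
      = D (e i) ^ 2 / G.val x (e i) (e i) := by ring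
    _ ≤ (4 * A * ∑ j, T (e j) (e i) * T (e j) (e i) / G.val x (e j) (e j)) /
          G.val x (e i) (e i) := div_le_div_of_nonneg_right hdi hi.le
    _ = 4 * A * ∑ j, T (e j) (e i) ^ 2 / (G.val x (e i) (e i) * G.val x (e j) (e j)) := by
        rw [Finset.mul_sum, Finset.mul_sum, Finset.sum_div]
        refine Finset.sum_congr rfl fun j _ ↦ ?_
        have hj := (hpos j).ne'
        field_simp

/-- **Kato's inequality `|d|α|| ≤ |∇α|`** at a point where the `C^m` `1`-form `α` (`1 ≤ m ≤ ∞`)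
does not vanish: with `|α| = (h⁻¹(α, α))^{1/2}`, `h⁻¹(d|α|, d|α|) ≤ |∇α|²_h = normSq (∇α)`.
(`|α|` is differentiable at such points; `d|α|² = 2|α| d|α|` and `kato_sq`.) Carron 1999HdR,
§4.a, proof of Prop. 4.2 ("si `α` est une forme différentielle lisse alors `|∇α|(x) ≥ |d|α||(x)`");
the first analytic ingredient of the proof of Thm. 4.3 (Carron 1999).
[cite: Carron1999HdR, §4.a, Prop. 4.2 (proof)] -/
theorem kato {m : ℕ∞ω} (hm : m ≤ (∞ : ℕ∞ω)) (h1 : 1 ≤ m)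
    {α : Π x : X, TangentSpace I x →L[ℝ] ℝ}
    (hα : ContMDiffAt I (I.prod 𝓘(ℝ, E →L[ℝ] ℝ)) m (oneFormSection α) x) (hx : α x ≠ 0) :
    (PseudoRiemannianMetric.ofRiemannian h).innerDual x
      (mvfderiv I (fun y ↦ Real.sqrt ((PseudoRiemannianMetric.ofRiemannian h).innerDual y
        (α y).toLinearMap (α y).toLinearMap)) x).toLinearMap
      (mvfderiv I (fun y ↦ Real.sqrt ((PseudoRiemannianMetric.ofRiemannian h).innerDual y
        (α y).toLinearMap (α y).toLinearMap)) x).toLinearMap ≤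
      (PseudoRiemannianMetric.ofRiemannian h).normSq x
        ((PseudoRiemannianMetric.ofRiemannian h).covDerivOneForm α x) := by
  have hm0 : m ≠ 0 := by
    intro h0; rw [h0] at h1; exact absurd h1 (by norm_num)
  have hsq := kato_sq h hm h1 hα
  have hnn : ∀ y, 0 ≤ (PseudoRiemannianMetric.ofRiemannian h).innerDual y (α y).toLinearMap
      (α y).toLinearMap := fun y ↦ innerDual_self_nonneg (h := h) y _
  set G := PseudoRiemannianMetric.ofRiemannian h with hG
  set N : X → ℝ := fun y ↦ G.innerDual y (α y).toLinearMap (α y).toLinearMap with hN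
  set f : X → ℝ := fun y ↦ Real.sqrt (N y) with hf_def
  -- `N x > 0`
  have hN0 : 0 < N x := by
    have hne : G.sharp x (α x).toLinearMap ≠ 0 := by
      intro h0
      apply hx
      have : (α x).toLinearMap = 0 := by simpa using congrArg (G.flat x) h0
      exact ContinuousLinearMap.coe_injective this
    simp only [hN, PseudoRiemannianMetric.innerDual_eq_val_sharp_sharp]
    exact h.pos x _ hne
  -- differentiability of `N` and of `f = √N`
  have hSα : MDiffAt (T% (fun y ↦ G.sharp y (α y).toLinearMap)) x :=
    (contMDiffAt_sharp_oneForm G hm hα).mdifferentiableAt hm0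
  have hNd : MDiffAt N x :=
    mdifferentiableAt_oneForm_apply (hα.mdifferentiableAt hm0) hSα
  have hsqrt : MDifferentiableAt 𝓘(ℝ, ℝ) 𝓘(ℝ, ℝ) Real.sqrt (N x) :=
    ((Real.hasDerivAt_sqrt hN0.ne')).differentiableAt.mdifferentiableAt
  have hfd : MDiffAt f x := hsqrt.comp x hNd
  have hff : f * f = N := funext fun y ↦ Real.mul_self_sqrt (hnn y)
  have hfx : 0 < f x := Real.sqrt_pos.2 hN0
  -- `dN = 2 f df`
  have key : mvfderiv I N x = (2 * f x) • mvfderiv I f x := by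
    rw [← hff, mvfderiv_mul hfd hfd, two_mul, add_smul]
  have key' : mvfderiv I f x = (1 / (2 * f x)) • mvfderiv I N x := by
    rw [key, smul_smul]
    field_simp
    simp
  rw [key']
  have hscale : ∀ (c : ℝ) (D : TangentSpace I x →L[ℝ] ℝ),
      G.innerDual x (c • D).toLinearMap (c • D).toLinearMap =
        c ^ 2 * G.innerDual x D.toLinearMap D.toLinearMap := by
    intro c D
    simp only [PseudoRiemannianMetric.innerDual, ContinuousLinearMap.toLinearMap_smul, map_smul,
      LinearMap.smul_apply, smul_eq_mul]
    ring
  rw [hscale]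
  have hfx2 : f x ^ 2 = N x := Real.sq_sqrt hN0.le
  calc (1 / (2 * f x)) ^ 2 * G.innerDual x (mvfderiv I N x).toLinearMap (mvfderiv I N x).toLinearMap
      ≤ (1 / (2 * f x)) ^ 2 * (4 * N x * G.normSq x (G.covDerivOneForm α x)) :=
        mul_le_mul_of_nonneg_left hsq (sq_nonneg _)
    _ = G.normSq x (G.covDerivOneForm α x) := by
        rw [← hfx2]
        field_simp
        ring

variable [T3Space X] [MeasurableSpace X] [BorelSpace X] in
/-- Kato's inequality `h⁻¹(d|α|, d|α|) ≤ |∇α|²_h` for the members of `ℋ¹(X, h)` (smooth `L²`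
harmonic `1`-forms), at every point where `α ≠ 0` — the form in which it enters the proof of
Carron's finiteness theorem (`Carron1999_finrank_l2HarmonicOneForms_le`; memoir §4.b via §4.a).
[cite: Carron1999HdR, §4.a, Prop. 4.2 (proof)] -/
theorem kato_of_mem_l2HarmonicOneForms {α : Π x : X, TangentSpace I x →L[ℝ] ℝ}
    (hα : α ∈ l2HarmonicOneForms h) (hx : α x ≠ 0) :
    (PseudoRiemannianMetric.ofRiemannian h).innerDual x
      (mvfderiv I (fun y ↦ Real.sqrt ((PseudoRiemannianMetric.ofRiemannian h).innerDual y
        (α y).toLinearMap (α y).toLinearMap)) x).toLinearMap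
      (mvfderiv I (fun y ↦ Real.sqrt ((PseudoRiemannianMetric.ofRiemannian h).innerDual y
        (α y).toLinearMap (α y).toLinearMap)) x).toLinearMap ≤
      (PseudoRiemannianMetric.ofRiemannian h).normSq x
        ((PseudoRiemannianMetric.ofRiemannian h).covDerivOneForm α x) :=
  kato h le_rfl (by exact_mod_cast le_top) (((mem_l2HarmonicOneForms_iff h).1 hα).1 x) hx

end Kato

end Literature.Geometry.Riemannian

end
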